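import Summits.BirchSwinnertonDyer.BirchSwinnertonDyer.Theorems.ManinLocalTwoThreeNewformPinningForty
import Summits.BirchSwinnertonDyer.BirchSwinnertonDyer.Theorems.ManinLocalTwoThreeEtaIdentityReductionFortyEight
import Summits.BirchSwinnertonDyer.BirchSwinnertonDyer.Theorems.ManinLocalTwoThreeNeronSqueezeTwenty
import HarnessLib

/-!
# Level 40: the `η`-identities of `X₀(40) → 40a1` reduce to three `q`-asymptotics at `i∞` — the cusp `1/20` handled by the
# `W = (1 0; 20 1)`-symmetry — and (S2)₄₀ `Λ(φ₄₀) ⊆ Λ(28, 24)`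

Cell bsd-f2-manin, route `ManinLocalTwoThree` (crux C2 `ManinOddAtFour`, stmt-22967: `2² ∣ 40`), prover seat p2 gen 27; level-`40` analogue of
p2 g26's `EtaIdentityReductionFortyEight` / `PeriodLatticeFortyEight` (second level of the C2 domain with `g(X₀(N)) > 1`).

OBJECTS: `x = η₄η₁₀⁵/(η₂η₂₀⁵) = q⁻² + 1 + ⋯` — the tree's LEVEL-`20` function of `LevelTwenty` (-an §95.11: `x₄₀ = x₂₀ − 1`) — and
`y = η₄²η₁₀⁴/η₂₀⁶ = q⁻³ − 2q + ⋯` (weight `0` on `Γ₀(40)`, supported on the divisors of `20`), `φ₄₀ = g₁ − 2g₂` (`NewformForty`); poles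
at the two cusps `∞`, `1/20` (the fibre of `X₀(40) → 40a1` over `O`).  IDENTITIES: **`y² = x³ − 3x² − 4x`** (`40a1 = [0, 0, 0, −7, −6]`
translated by `1`), `x′ = −2πiφ₄₀·2y`, `y′ = −2πiφ₄₀·(3x² − 6x − 4)`; with `X = x − 1`: `(X′)² = (2πiφ₄₀)²(4X³ − 28X − 24)`.

* §1 `x, y` are `Γ₀(40)`-invariant; at the cusps `a/c` with `20 ∤ c` they are bounded (Ligozat orders `≥ 0`); at the cusp `1/20`
  (`20 ∣ c`, `40 ∤ c`) one has `A = g·W`, `g ∈ Γ₀(40)`, `W = (1 0; 20 1) ∈ Γ₀(20)`, and `x∘W = x`, `y∘W = −y`, `φ₄₀|W = −φ₄₀`, so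
  `R|A = R|W = ±R` for `R₁ = (2πi)⁻¹x′ + φ₄₀·2y`, `R₂ = (2πi)⁻¹y′ + φ₄₀(3x² − 6x − 4)` (p2 g26's general cusp-form argument
  `EtaIdentityReductionFortyEight.deriv_eq_of_tendsto_pow_of`, Sturm at `40` with `m = 6`).
* §2 (T1) `R₁/q⁶ → 0` ⟹ `x′ = −2πiφ₄₀·2y`; (T2) `R₂/q⁶ → 0` ⟹ `y′ = −2πiφ₄₀(3x² − 6x − 4)`; with (T3) `x³ − 3x² − 4x − y² → 0` the cubic;
  non-degeneracy and the analytic bridge on `X = x − 1` ⟹ **(S2)₄₀ `Λ(φ₄₀) ⊆ Λ(28, 24)`**.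

HONEST FRAMING: hypotheses (T1)–(T3) only (discharged in `…EtaIdentitiesForty`); nothing here proves C2, Manin's conjecture or BSD.
No definition, no named fact, no sorry. [cite: Ligozat1975, Ch. 3–4] [cite: CremonaAlgorithms1997, Table 1 (40a1), §2.10]
[cite: DiamondShurman2005, §1.2, Thm. 3.5.1]
-/

set_option autoImplicit false
-- lint-debt: the directory name repeats the summit name (sibling precedent `ManinLocalTwoThreeEtaIdentityReductionFortyEight.lean`)
set_option linter.dupNamespace false

noncomputable section

open Complex Filter Topology Set Function Asymptotics
open UpperHalfPlane hiding I
open scoped Real Topology Manifold MatrixGroups ModularForm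
open ModularForm CongruenceSubgroup
open Literature.NumberTheory.EllipticCurves Literature.NumberTheory.EllipticCurves.ModularForms

namespace Summit.BirchSwinnertonDyer.BirchSwinnertonDyer.Theorems.ManinLocalTwoThree.EtaIdentityReductionForty

open CuspToolkit AnalyticBridge EtaIdentityReductionThirtySix EtaIdentityReductionFortyEight NewformForty
open EtaQuotientLowerUnipotent (etaQuotient_smul_lowerUnipotent_of_dvd)

/-! ## §1 `x, y` at level `40`: invariance, the cusps with `20 ∤ c`, and the cusp `1/20` via `W = (1 0; 20 1)` -/

/-- `Γ₀(40) ≤ Γ₀(20)`. [folklore] -/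
theorem mem_Gamma0_twenty_of_mem_forty {γ : SL(2, ℤ)} (hγ : γ ∈ Gamma0 40) : γ ∈ Gamma0 20 := by
  rw [Gamma0_mem, ZMod.intCast_zmod_eq_zero_iff_dvd] at hγ ⊢
  exact (show (20 : ℤ) ∣ 40 by norm_num).trans hγ

/-- `x(γτ) = x(τ)` for `γ ∈ Γ₀(40)` (`x` is a level-`20` function). [folklore] -/
theorem x40_smul (γ : SL(2, ℤ)) (hγ : γ ∈ Gamma0 40) (τ : ℍ) :
    etaQuotient 20 (expFn [(2, -1), (4, 1), (10, 5), (20, -5)]) (γ • τ)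
      = etaQuotient 20 (expFn [(2, -1), (4, 1), (10, 5), (20, -5)]) τ :=
  LevelTwenty.x20_smul ⟨γ, mem_Gamma0_twenty_of_mem_forty hγ⟩ τ

/-- Newman's conditions for `y = η₄²η₁₀⁴/η₂₀⁶` in weight `0` at level `40` (`Σ(40/δ)r = 24`, `∏ δ^{|r|} = 3200000²`). [folklore] -/
theorem newmanCond_y40 : NewmanCond 40 (expFn [(4, 2), (10, 4), (20, -6)]) 0 :=
  ⟨by decide, by decide, by decide, ⟨3200000, by decide⟩⟩

/-- `y(γτ) = y(τ)` for `γ ∈ Γ₀(40)`. [folklore] -/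
theorem y40_smul (γ : SL(2, ℤ)) (hγ : γ ∈ Gamma0 40) (τ : ℍ) :
    etaQuotient 40 (expFn [(4, 2), (10, 4), (20, -6)]) (γ • τ) = etaQuotient 40 (expFn [(4, 2), (10, 4), (20, -6)]) τ := by
  have h := etaQuotient_smul_of_mem_Gamma0 40 (by norm_num) _ 0 ⟨0, by simp⟩ newmanCond_y40 hγ τ
  rwa [zpow_zero, one_mul] at h

/-- `A ∉ Γ₀(20)` when `20 ∤ c(A)`. [folklore] -/
theorem not_mem20_of_not_dvd {A : SL(2, ℤ)} (hA : ¬ (20 : ℤ) ∣ A 1 0) : A ∉ Gamma0 20 := fun h ↦ by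
  rw [Gamma0_mem, ZMod.intCast_zmod_eq_zero_iff_dvd] at h; exact hA (by exact_mod_cast h)

/-- `x ∘ A` is bounded at `i∞` when `20 ∤ c(A)` (the tree's level-`20` cusp analysis of `x`). [cite: Ligozat1975, Ch. 3] -/
theorem isBoundedAtImInfty_x40_smul {A : SL(2, ℤ)} (hA : ¬ (20 : ℤ) ∣ A 1 0) :
    IsBoundedAtImInfty (fun τ : ℍ ↦ etaQuotient 20 (expFn [(2, -1), (4, 1), (10, 5), (20, -5)]) (A • τ)) :=
  LevelTwenty.isBoundedAtImInfty_x20_smul (not_mem20_of_not_dvd hA)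

/-- Ligozat's order at level `40` is `≥ 0` at every `c` with `20 ∤ c`, given the values at the divisors `≠ 20, 40`. [cite: Ligozat1975, Ch. 3] -/
theorem cuspOrder24_nonneg_of_not_dvd40 (r : ℕ → ℤ)
    (h : ∀ t ∈ Nat.divisors 40, t ≠ 20 → t ≠ 40 → 0 ≤ cuspOrder24 40 r t) {c : ℤ} (hc : ¬ (20 : ℤ) ∣ c) :
    0 ≤ cuspOrder24 40 r c := by
  rw [cuspOrder24_eq_gcd]
  have h20 : ¬ 20 ∣ Nat.gcd 40 c.natAbs := fun hd ↦ hc (Int.natCast_dvd.mpr (hd.trans (Nat.gcd_dvd_right _ _)))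
  refine h _ (Nat.mem_divisors.mpr ⟨Nat.gcd_dvd_left _ _, by norm_num⟩) ?_ ?_
  · intro h'; apply h20; rw [h']
  · intro h'; apply h20; rw [h']; norm_num

/-- `y ∘ A` is bounded at `i∞` when `20 ∤ c(A)` (Ligozat orders `1,1,1,1,1,1` at the cusps `1/c`, `c ∣ 40`, `c ≠ 20, 40`).
[cite: Ligozat1975, Ch. 3] -/
theorem isBoundedAtImInfty_y40_smul {A : SL(2, ℤ)} (hA : ¬ (20 : ℤ) ∣ A 1 0) :
    IsBoundedAtImInfty (fun τ : ℍ ↦ etaQuotient 40 (expFn [(4, 2), (10, 4), (20, -6)]) (A • τ)) :=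
  isBoundedAtImInfty_etaQuotient_smul 40 (by norm_num) _ (by decide) A
    (cuspOrder24_nonneg_of_not_dvd40 _ (by decide) hA)

/-- An `η`-quotient of level `40` supported on the divisors of `20` is the same product at level `20`. [folklore] -/
theorem etaQuotient40_eq_20 (L : List (ℕ × ℤ)) (h8 : expFn L 8 = 0) (h40 : expFn L 40 = 0) (τ : ℍ) :
    etaQuotient 40 (expFn L) τ = etaQuotient 20 (expFn L) τ := by
  rw [etaQuotient_apply, etaQuotient_apply]
  symm
  refine Finset.prod_subset (Nat.divisors_subset_of_dvd (by norm_num) (by norm_num)) fun t ht hnt ↦ ?_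
  rw [show Nat.divisors 40 = {1, 2, 4, 5, 8, 10, 20, 40} by decide] at ht
  rw [show Nat.divisors 20 = {1, 2, 4, 5, 10, 20} by decide] at hnt
  simp only [Finset.mem_insert, Finset.mem_singleton] at ht hnt
  rcases ht with rfl | rfl | rfl | rfl | rfl | rfl | rfl | rfl <;> simp_all

/-- **`x∘W = x`** for `W = (1 0; 20 1) ∈ Γ₀(20)`. [folklore] -/
theorem x40_smul_W (W : SL(2, ℤ)) (h10 : W 1 0 = 20) (τ : ℍ) :
    etaQuotient 20 (expFn [(2, -1), (4, 1), (10, 5), (20, -5)]) (W • τ)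
      = etaQuotient 20 (expFn [(2, -1), (4, 1), (10, 5), (20, -5)]) τ :=
  LevelTwenty.x20_smul ⟨W, mem_Gamma0_twenty_of_entries W h10⟩ τ

/-- **`y∘W = −y`** for `W = (1 0; 20 1)` (weight `0`, level `20`, `Σ(20/δ)r_δ = 10 + 8 − 6 = 12`: log period `½`).
[cite: Apostol1990, Thm. 3.4] -/
theorem y40_smul_W (W : SL(2, ℤ)) (h00 : W 0 0 = 1) (h01 : W 0 1 = 0) (h10 : W 1 0 = 20) (h11 : W 1 1 = 1) (τ : ℍ) :
    etaQuotient 40 (expFn [(4, 2), (10, 4), (20, -6)]) (W • τ) = -etaQuotient 40 (expFn [(4, 2), (10, 4), (20, -6)]) τ := by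
  rw [etaQuotient40_eq_20 _ (by decide) (by decide), etaQuotient40_eq_20 _ (by decide) (by decide)]
  exact EtaQuotientLowerUnipotent.etaQuotient_smul_lowerUnipotent_of_mod 20 (by norm_num) _ (by decide) (by decide) W h00 h01
    (by rw [h10]; norm_num) h11 τ

/-- **`A = g·W` with `g ∈ Γ₀(40)`** for `A ∈ SL₂(ℤ)` with `20 ∣ c(A)`, `40 ∤ c(A)` and `W = (1 0; 20 1)`: the cusp `A∞` is the cusp
`1/20` (`g = AW⁻¹`, `c(g) = c − 20d ≡ 0 (mod 40)` as `c/20` and `d` are odd). [cite: DiamondShurman2005, §3.8] -/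
theorem exists_mem_Gamma0_mul_W {A : SL(2, ℤ)} (h20 : (20 : ℤ) ∣ A 1 0) (hA : A ∉ Gamma0 40) :
    ∃ g W : SL(2, ℤ), g ∈ Gamma0 40 ∧ W 0 0 = 1 ∧ W 0 1 = 0 ∧ W 1 0 = 20 ∧ W 1 1 = 1 ∧ A = g * W := by
  let W : SL(2, ℤ) := ⟨!![1, 0; 20, 1], by norm_num [Matrix.det_fin_two_of]⟩
  refine ⟨A * W⁻¹, W, ?_, rfl, rfl, rfl, rfl, by rw [inv_mul_cancel_right]⟩
  obtain ⟨m, hm⟩ := h20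
  have h40 : ¬ (40 : ℤ) ∣ A 1 0 := fun h ↦ hA (by rw [Gamma0_mem]; exact (ZMod.intCast_zmod_eq_zero_iff_dvd _ 40).mpr h)
  have hdet : A 0 0 * A 1 1 - A 0 1 * A 1 0 = 1 := by
    have h := Matrix.det_fin_two (A : Matrix (Fin 2) (Fin 2) ℤ)
    rw [A.det_coe] at h
    linarith
  have hmodd : Odd m := (Int.even_or_odd m).resolve_left fun ⟨k, hk⟩ ↦ h40 ⟨k, by rw [hm, hk]; ring⟩
  have hdodd : Odd (A 1 1) := by
    have hprod : Odd (A 0 0 * A 1 1) := ⟨A 0 1 * 10 * m, by rw [hm] at hdet; linear_combination hdet⟩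
    exact (Int.odd_mul.mp hprod).2
  obtain ⟨i, hi⟩ := hmodd
  obtain ⟨j, hj⟩ := hdodd
  have hg10 : (A * W⁻¹) 1 0 = A 1 0 - 20 * A 1 1 := by
    rw [Matrix.SpecialLinearGroup.SL2_inv_expl]
    simp [Matrix.mul_apply, Fin.sum_univ_two, W]
    ring
  rw [Gamma0_mem, hg10]
  refine (ZMod.intCast_zmod_eq_zero_iff_dvd _ 40).mpr ⟨i - j, ?_⟩
  rw [hm, hi, hj]
  ring

section Phi

variable (φ : CuspForm (Gamma0 40) 2)
  (hφ : ⇑φ = fun τ ↦ etaQuotient 40 (expFn [(1, -2), (2, 5), (4, -1), (5, 2), (10, -1), (20, 1)]) τ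
      - 2 * etaQuotient 40 (expFn [(4, 2), (20, 2)]) τ)
include hφ

/-- **`R₁|A → 0` at `i∞` for every `A ∉ Γ₀(40)`**, `R₁ = (2πi)⁻¹x′ + φ₄₀·2y`, once `R₁ → 0` at `i∞`: at the cusps with `20 ∤ c` by
boundedness of `x, y`; at the cusp `1/20` because `R₁|A = R₁|W = R₁` (`x∘W = x`, `φ₄₀|W = −φ₄₀`, `y∘W = −y`). [cite: DiamondShurman2005, §1.2] -/
theorem isZeroAtImInfty_slash_R1 (h0 : IsZeroAtImInfty (fun σ : ℍ ↦ (2 * π * I)⁻¹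
      * deriv (etaQuotient 20 (expFn [(2, -1), (4, 1), (10, 5), (20, -5)]) ∘ ofComplex) σ
      + φ σ * (2 * etaQuotient 40 (expFn [(4, 2), (10, 4), (20, -6)]) σ)))
    (A : SL(2, ℤ)) (hA : A ∉ Gamma0 40) :
    IsZeroAtImInfty ((fun σ : ℍ ↦ (2 * π * I)⁻¹
      * deriv (etaQuotient 20 (expFn [(2, -1), (4, 1), (10, 5), (20, -5)]) ∘ ofComplex) σ
      + φ σ * (2 * etaQuotient 40 (expFn [(4, 2), (10, 4), (20, -6)]) σ)) ∣[(2 : ℤ)] A) := by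
  by_cases h20 : (20 : ℤ) ∣ A 1 0
  · obtain ⟨g, W, hg, h00, h01, h10, h11, rfl⟩ := exists_mem_Gamma0_mul_W h20 hA
    rw [SlashAction.slash_mul, slash_eq_self_of_mem φ _ _ (mdifferentiable_etaQuotient 20 _) x40_smul
      (fun γ hγ τ ↦ by simp only [y40_smul γ hγ τ]) hg]
    have hfun : ((fun σ : ℍ ↦ (2 * π * I)⁻¹
        * deriv (etaQuotient 20 (expFn [(2, -1), (4, 1), (10, 5), (20, -5)]) ∘ ofComplex) σ
        + φ σ * (2 * etaQuotient 40 (expFn [(4, 2), (10, 4), (20, -6)]) σ)) ∣[(2 : ℤ)] W)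
        = fun σ : ℍ ↦ (2 * π * I)⁻¹
          * deriv (etaQuotient 20 (expFn [(2, -1), (4, 1), (10, 5), (20, -5)]) ∘ ofComplex) σ
          + φ σ * (2 * etaQuotient 40 (expFn [(4, 2), (10, 4), (20, -6)]) σ) := by
      funext τ
      rw [slash_two_apply_of φ _ (mdifferentiable_etaQuotient 20 _) W τ,
        show (fun σ : ℍ ↦ etaQuotient 20 (expFn [(2, -1), (4, 1), (10, 5), (20, -5)]) (W • σ))
          = etaQuotient 20 (expFn [(2, -1), (4, 1), (10, 5), (20, -5)]) from funext (x40_smul_W W h10),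
        y40_smul_W W h00 h01 h10 h11, phi40_slash_W φ hφ W h00 h01 h10 h11]
      ring
    rw [hfun]
    exact h0
  · exact isZeroAtImInfty_slash_of_isBoundedAtImInfty φ _ _ (mdifferentiable_etaQuotient 20 _) A
      (isBoundedAtImInfty_x40_smul h20) ((isBoundedAtImInfty_y40_smul h20).const_mul_left 2)

/-- **`R₂|A → 0` at `i∞` for every `A ∉ Γ₀(40)`**, `R₂ = (2πi)⁻¹y′ + φ₄₀(3x² − 6x − 4)`, once `R₂ → 0` at `i∞`
(at the cusp `1/20`: `R₂|A = R₂|W = −R₂`). [cite: DiamondShurman2005, §1.2] -/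
theorem isZeroAtImInfty_slash_R2 (h0 : IsZeroAtImInfty (fun σ : ℍ ↦ (2 * π * I)⁻¹
      * deriv (etaQuotient 40 (expFn [(4, 2), (10, 4), (20, -6)]) ∘ ofComplex) σ
      + φ σ * (3 * etaQuotient 20 (expFn [(2, -1), (4, 1), (10, 5), (20, -5)]) σ ^ 2
        - 6 * etaQuotient 20 (expFn [(2, -1), (4, 1), (10, 5), (20, -5)]) σ - 4)))
    (A : SL(2, ℤ)) (hA : A ∉ Gamma0 40) :
    IsZeroAtImInfty ((fun σ : ℍ ↦ (2 * π * I)⁻¹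
      * deriv (etaQuotient 40 (expFn [(4, 2), (10, 4), (20, -6)]) ∘ ofComplex) σ
      + φ σ * (3 * etaQuotient 20 (expFn [(2, -1), (4, 1), (10, 5), (20, -5)]) σ ^ 2
        - 6 * etaQuotient 20 (expFn [(2, -1), (4, 1), (10, 5), (20, -5)]) σ - 4)) ∣[(2 : ℤ)] A) := by
  by_cases h20 : (20 : ℤ) ∣ A 1 0
  · obtain ⟨g, W, hg, h00, h01, h10, h11, rfl⟩ := exists_mem_Gamma0_mul_W h20 hA
    rw [SlashAction.slash_mul, slash_eq_self_of_mem φ _ _ (mdifferentiable_etaQuotient 40 _) y40_smul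
      (fun γ hγ τ ↦ by simp only [x40_smul γ hγ τ]) hg]
    have hyW : (fun σ : ℍ ↦ etaQuotient 40 (expFn [(4, 2), (10, 4), (20, -6)]) (W • σ))
        = fun σ : ℍ ↦ -etaQuotient 40 (expFn [(4, 2), (10, 4), (20, -6)]) σ :=
      funext (y40_smul_W W h00 h01 h10 h11)
    have hderiv : ∀ τ : ℍ, deriv ((fun σ : ℍ ↦ -etaQuotient 40 (expFn [(4, 2), (10, 4), (20, -6)]) σ) ∘ ofComplex) τ
        = -deriv (etaQuotient 40 (expFn [(4, 2), (10, 4), (20, -6)]) ∘ ofComplex) τ := by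
      intro τ
      show deriv (-(etaQuotient 40 (expFn [(4, 2), (10, 4), (20, -6)]) ∘ ofComplex)) (τ : ℂ) = _
      exact deriv.neg
    have hfun : ((fun σ : ℍ ↦ (2 * π * I)⁻¹
        * deriv (etaQuotient 40 (expFn [(4, 2), (10, 4), (20, -6)]) ∘ ofComplex) σ
        + φ σ * (3 * etaQuotient 20 (expFn [(2, -1), (4, 1), (10, 5), (20, -5)]) σ ^ 2
          - 6 * etaQuotient 20 (expFn [(2, -1), (4, 1), (10, 5), (20, -5)]) σ - 4)) ∣[(2 : ℤ)] W)
        = fun σ : ℍ ↦ -((2 * π * I)⁻¹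
          * deriv (etaQuotient 40 (expFn [(4, 2), (10, 4), (20, -6)]) ∘ ofComplex) σ
          + φ σ * (3 * etaQuotient 20 (expFn [(2, -1), (4, 1), (10, 5), (20, -5)]) σ ^ 2
            - 6 * etaQuotient 20 (expFn [(2, -1), (4, 1), (10, 5), (20, -5)]) σ - 4)) := by
      funext τ
      rw [slash_two_apply_of φ _ (mdifferentiable_etaQuotient 40 _) W τ, hyW, hderiv τ,
        x40_smul_W W h10, phi40_slash_W φ hφ W h00 h01 h10 h11]
      ring
    rw [hfun]
    exact h0.neg
  · refine isZeroAtImInfty_slash_of_isBoundedAtImInfty φ _ _ (mdifferentiable_etaQuotient 40 _) A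
      (isBoundedAtImInfty_y40_smul h20) ?_
    exact ((((isBoundedAtImInfty_x40_smul h20).mul (isBoundedAtImInfty_x40_smul h20)).const_mul_left 3 |>.sub
      ((isBoundedAtImInfty_x40_smul h20).const_mul_left 6)).sub (const_boundedAtFilter atImInfty (4 : ℂ))).congr_left
      fun τ ↦ by simp only [Pi.mul_apply, Function.const_apply]; ring

/-! ## §2 The three limits ⟹ the identities ⟹ (S2)₄₀ -/

/-- **(I2a) from (T1)**: `x′ = −2πi φ₄₀ · 2y` on `ℍ`. [cite: Ligozat1975, Ch. 4] -/
theorem deriv_x40_of_tendsto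
    (hT1 : Tendsto (fun τ : ℍ ↦ ((2 * π * I)⁻¹
      * deriv (etaQuotient 20 (expFn [(2, -1), (4, 1), (10, 5), (20, -5)]) ∘ ofComplex) τ
      + φ τ * (2 * etaQuotient 40 (expFn [(4, 2), (10, 4), (20, -6)]) τ))
      / Function.Periodic.qParam 1 (τ : ℂ) ^ 6) atImInfty (𝓝 0)) :
    ∀ τ : ℍ, deriv (etaQuotient 20 (expFn [(2, -1), (4, 1), (10, 5), (20, -5)]) ∘ ofComplex) τ
      = -(2 * π * I * φ τ) * (2 * etaQuotient 40 (expFn [(4, 2), (10, 4), (20, -6)]) τ) := by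
  have hq : Tendsto (fun τ : ℍ ↦ Function.Periodic.qParam 1 (τ : ℂ) ^ 6) atImInfty (𝓝 0) := by
    simpa only [zpow_natCast] using tendsto_qParam_zpow_atImInfty (m := ((6 : ℕ) : ℤ)) (by norm_num)
  have h0 := hT1.mul hq
  rw [zero_mul] at h0
  refine deriv_eq_of_tendsto_pow_of φ 6 (by norm_num) (fun S hS ↦ cuspForm_forty_eq_zero_of_tendsto S hS) _
    (fun τ ↦ 2 * etaQuotient 40 (expFn [(4, 2), (10, 4), (20, -6)]) τ)
    (mdifferentiable_etaQuotient 20 _) ((mdifferentiable_etaQuotient 40 _).const_smul (2 : ℂ)) x40_smul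
    (fun γ hγ τ ↦ by simp only [y40_smul γ hγ τ]) (isZeroAtImInfty_slash_R1 φ hφ ?_) hT1
  refine (h0.congr fun τ ↦ ?_)
  exact div_mul_cancel₀ _ (pow_ne_zero _ (Complex.exp_ne_zero _))

/-- **(I2b) from (T2)**: `y′ = −2πi φ₄₀ · (3x² − 6x − 4)` on `ℍ`. [cite: Ligozat1975, Ch. 4] -/
theorem deriv_y40_of_tendsto
    (hT2 : Tendsto (fun τ : ℍ ↦ ((2 * π * I)⁻¹
      * deriv (etaQuotient 40 (expFn [(4, 2), (10, 4), (20, -6)]) ∘ ofComplex) τ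
      + φ τ * (3 * etaQuotient 20 (expFn [(2, -1), (4, 1), (10, 5), (20, -5)]) τ ^ 2
        - 6 * etaQuotient 20 (expFn [(2, -1), (4, 1), (10, 5), (20, -5)]) τ - 4))
      / Function.Periodic.qParam 1 (τ : ℂ) ^ 6) atImInfty (𝓝 0)) :
    ∀ τ : ℍ, deriv (etaQuotient 40 (expFn [(4, 2), (10, 4), (20, -6)]) ∘ ofComplex) τ
      = -(2 * π * I * φ τ)
          * (3 * etaQuotient 20 (expFn [(2, -1), (4, 1), (10, 5), (20, -5)]) τ ^ 2
            - 6 * etaQuotient 20 (expFn [(2, -1), (4, 1), (10, 5), (20, -5)]) τ - 4) := by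
  have hq : Tendsto (fun τ : ℍ ↦ Function.Periodic.qParam 1 (τ : ℂ) ^ 6) atImInfty (𝓝 0) := by
    simpa only [zpow_natCast] using tendsto_qParam_zpow_atImInfty (m := ((6 : ℕ) : ℤ)) (by norm_num)
  have h0 := hT2.mul hq
  rw [zero_mul] at h0
  refine deriv_eq_of_tendsto_pow_of φ 6 (by norm_num) (fun S hS ↦ cuspForm_forty_eq_zero_of_tendsto S hS) _
    (fun τ ↦ 3 * etaQuotient 20 (expFn [(2, -1), (4, 1), (10, 5), (20, -5)]) τ ^ 2
      - 6 * etaQuotient 20 (expFn [(2, -1), (4, 1), (10, 5), (20, -5)]) τ - 4)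
    (mdifferentiable_etaQuotient 40 _) ?_ y40_smul (fun γ hγ τ ↦ by simp only [x40_smul γ hγ τ])
    (isZeroAtImInfty_slash_R2 φ hφ ?_) hT2
  · exact ((((mdifferentiable_etaQuotient 20 _).pow 2).const_smul (3 : ℂ)).sub
      ((mdifferentiable_etaQuotient 20 _).const_smul (6 : ℂ))).sub mdifferentiable_const
  · refine (h0.congr fun τ ↦ ?_)
    exact div_mul_cancel₀ _ (pow_ne_zero _ (Complex.exp_ne_zero _))

omit hφ in
/-- **(I1) from (I2a), (I2b), (T3)**: `x³ − 3x² − 4x = y²` on `ℍ`. [cite: Ligozat1975, Ch. 4] -/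
theorem cubic40_of_deriv
    (hx : ∀ τ : ℍ, deriv (etaQuotient 20 (expFn [(2, -1), (4, 1), (10, 5), (20, -5)]) ∘ ofComplex) τ
      = -(2 * π * I * φ τ) * (2 * etaQuotient 40 (expFn [(4, 2), (10, 4), (20, -6)]) τ))
    (hy : ∀ τ : ℍ, deriv (etaQuotient 40 (expFn [(4, 2), (10, 4), (20, -6)]) ∘ ofComplex) τ
      = -(2 * π * I * φ τ)
          * (3 * etaQuotient 20 (expFn [(2, -1), (4, 1), (10, 5), (20, -5)]) τ ^ 2
            - 6 * etaQuotient 20 (expFn [(2, -1), (4, 1), (10, 5), (20, -5)]) τ - 4))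
    (hT3 : Tendsto (fun τ : ℍ ↦ etaQuotient 20 (expFn [(2, -1), (4, 1), (10, 5), (20, -5)]) τ ^ 3
      - 3 * etaQuotient 20 (expFn [(2, -1), (4, 1), (10, 5), (20, -5)]) τ ^ 2
      - 4 * etaQuotient 20 (expFn [(2, -1), (4, 1), (10, 5), (20, -5)]) τ
      - etaQuotient 40 (expFn [(4, 2), (10, 4), (20, -6)]) τ ^ 2) atImInfty (𝓝 0)) :
    ∀ τ : ℍ, etaQuotient 20 (expFn [(2, -1), (4, 1), (10, 5), (20, -5)]) τ ^ 3
      - 3 * etaQuotient 20 (expFn [(2, -1), (4, 1), (10, 5), (20, -5)]) τ ^ 2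
      - 4 * etaQuotient 20 (expFn [(2, -1), (4, 1), (10, 5), (20, -5)]) τ
      = etaQuotient 40 (expFn [(4, 2), (10, 4), (20, -6)]) τ ^ 2 := by
  set X : ℍ → ℂ := etaQuotient 20 (expFn [(2, -1), (4, 1), (10, 5), (20, -5)]) with hX
  set Y : ℍ → ℂ := etaQuotient 40 (expFn [(4, 2), (10, 4), (20, -6)]) with hY
  have hXd := UpperHalfPlane.mdifferentiable_iff.mp (mdifferentiable_etaQuotient 20 (expFn [(2, -1), (4, 1), (10, 5), (20, -5)]))
  have hYd := UpperHalfPlane.mdifferentiable_iff.mp (mdifferentiable_etaQuotient 40 (expFn [(4, 2), (10, 4), (20, -6)]))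
  have hderiv : ∀ z ∈ {z : ℂ | 0 < z.im}, deriv (fun z : ℂ ↦ (X ∘ ofComplex) z ^ 3 - 3 * (X ∘ ofComplex) z ^ 2
      - 4 * (X ∘ ofComplex) z - (Y ∘ ofComplex) z ^ 2) z = 0 := by
    intro z hz
    have h1 : HasDerivAt (X ∘ ofComplex) (deriv (X ∘ ofComplex) z) z :=
      ((hXd z hz).differentiableAt (isOpen_upperHalfPlaneSet.mem_nhds hz)).hasDerivAt
    have h2 : HasDerivAt (Y ∘ ofComplex) (deriv (Y ∘ ofComplex) z) z :=
      ((hYd z hz).differentiableAt (isOpen_upperHalfPlaneSet.mem_nhds hz)).hasDerivAt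
    have hPd := (((h1.pow 3).sub ((h1.pow 2).const_mul 3)).sub (h1.const_mul 4)).sub (h2.pow 2)
    have hfun : (fun z : ℂ ↦ (X ∘ ofComplex) z ^ 3 - 3 * (X ∘ ofComplex) z ^ 2 - 4 * (X ∘ ofComplex) z - (Y ∘ ofComplex) z ^ 2)
        = (((X ∘ ofComplex ^ 3 - fun v ↦ 3 * (X ∘ ofComplex ^ 2) v) - fun v ↦ 4 * (X ∘ ofComplex) v) - Y ∘ ofComplex ^ 2) := by
      funext w
      simp only [Pi.sub_apply, Pi.pow_apply]
    rw [hfun, hPd.deriv]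
    have hx' := hx ⟨z, hz⟩
    have hy' := hy ⟨z, hz⟩
    have hcoe : ((⟨z, hz⟩ : ℍ) : ℂ) = z := rfl
    rw [hcoe] at hx' hy'
    simp only [Function.comp_apply, ofComplex_apply_of_im_pos hz]
    rw [hx', hy', show (3 : ℕ) - 1 = 2 from rfl, show (2 : ℕ) - 1 = 1 from rfl]
    push_cast
    ring
  have hPdiff : DifferentiableOn ℂ (fun z : ℂ ↦ (X ∘ ofComplex) z ^ 3 - 3 * (X ∘ ofComplex) z ^ 2
      - 4 * (X ∘ ofComplex) z - (Y ∘ ofComplex) z ^ 2) {z : ℂ | 0 < z.im} :=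
    (((hXd.pow 3).sub ((hXd.pow 2).const_mul 3)).sub (hXd.const_mul 4)).sub (hYd.pow 2)
  have hconst : ∀ z ∈ {z : ℂ | 0 < z.im}, ∀ w ∈ {z : ℂ | 0 < z.im},
      (fun z : ℂ ↦ (X ∘ ofComplex) z ^ 3 - 3 * (X ∘ ofComplex) z ^ 2 - 4 * (X ∘ ofComplex) z - (Y ∘ ofComplex) z ^ 2) z
        = (fun z : ℂ ↦ (X ∘ ofComplex) z ^ 3 - 3 * (X ∘ ofComplex) z ^ 2 - 4 * (X ∘ ofComplex) z - (Y ∘ ofComplex) z ^ 2) w :=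
    fun z hz w hw ↦ isOpen_upperHalfPlaneSet.is_const_of_deriv_eq_zero
      convex_setOf_im_pos.isPreconnected hPdiff hderiv hz hw
  intro τ
  have hlim : Tendsto (fun σ : ℍ ↦ X σ ^ 3 - 3 * X σ ^ 2 - 4 * X σ - Y σ ^ 2) atImInfty
      (𝓝 (X τ ^ 3 - 3 * X τ ^ 2 - 4 * X τ - Y τ ^ 2)) := by
    refine tendsto_const_nhds.congr fun σ ↦ ?_
    have h := hconst _ τ.im_pos _ σ.im_pos
    simp only [Function.comp_apply, ofComplex_apply] at h
    exact h
  have h0 : X τ ^ 3 - 3 * X τ ^ 2 - 4 * X τ - Y τ ^ 2 = 0 := tendsto_nhds_unique hlim hT3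
  linear_combination h0

omit hφ in
/-- Non-degeneracy on `X = x − 1`: `4X³ − 28X − 24 = 4(x³ − 3x² − 4x)` is not identically `0`
(else `(xq²)³ → 1` contradicts `x³q⁶ = (3x² + 4x)q⁶ → 0`). [folklore] -/
theorem exists_x40_nondegenerate :
    ∃ τ₀ : ℍ, 4 * (etaQuotient 20 (expFn [(2, -1), (4, 1), (10, 5), (20, -5)]) τ₀ - 1) ^ 3
      - 28 * (etaQuotient 20 (expFn [(2, -1), (4, 1), (10, 5), (20, -5)]) τ₀ - 1) - 24 ≠ 0 := by
  by_contra hne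
  push Not at hne
  have hx3 : ∀ τ : ℍ, etaQuotient 20 (expFn [(2, -1), (4, 1), (10, 5), (20, -5)]) τ ^ 3
      = 3 * etaQuotient 20 (expFn [(2, -1), (4, 1), (10, 5), (20, -5)]) τ ^ 2
        + 4 * etaQuotient 20 (expFn [(2, -1), (4, 1), (10, 5), (20, -5)]) τ :=
    fun τ ↦ by linear_combination (1 / 4 : ℂ) * hne τ
  have hq := tendsto_qParam_zpow_atImInfty (m := 2) (by norm_num)
  have hxq := NeronSqueezeTwenty.tendsto_x20_mul_qParam_sq
  have h1 : Tendsto (fun τ : ℍ ↦ (etaQuotient 20 (expFn [(2, -1), (4, 1), (10, 5), (20, -5)]) τ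
      * Function.Periodic.qParam 1 (τ : ℂ) ^ (2 : ℤ)) ^ 3) atImInfty (𝓝 1) := by
    simpa using hxq.pow 3
  have h2 : Tendsto (fun τ : ℍ ↦ (etaQuotient 20 (expFn [(2, -1), (4, 1), (10, 5), (20, -5)]) τ
      * Function.Periodic.qParam 1 (τ : ℂ) ^ (2 : ℤ)) ^ 3) atImInfty (𝓝 0) := by
    have h := (((hxq.pow 2).mul hq).const_mul 3).add ((((hxq.const_mul 4).mul hq).mul hq))
    simp only [one_pow, mul_zero, add_zero] at h
    refine h.congr fun τ ↦ ?_
    rw [mul_pow _ _ 3, hx3]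
    ring
  exact one_ne_zero (tendsto_nhds_unique h1 h2)

/-- **(S2)₄₀ from (I1), (I2a)**: the period lattice of `φ₄₀` lies in the lattice of the Weierstrass pair with invariants
`g₂ = 28 = c₄/12`, `g₃ = 24 = c₆/216` of `40a1 = [0, 0, 0, −7, −6]` (analytic bridge on `X = x − 1`).
[cite: CremonaAlgorithms1997, §2.10, Table 1 (40a1)] -/
theorem periodLatticeLe40_of_etaIdentities
    (h1 : ∀ τ : ℍ, etaQuotient 20 (expFn [(2, -1), (4, 1), (10, 5), (20, -5)]) τ ^ 3
      - 3 * etaQuotient 20 (expFn [(2, -1), (4, 1), (10, 5), (20, -5)]) τ ^ 2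
      - 4 * etaQuotient 20 (expFn [(2, -1), (4, 1), (10, 5), (20, -5)]) τ
      = etaQuotient 40 (expFn [(4, 2), (10, 4), (20, -6)]) τ ^ 2)
    (h2 : ∀ τ : ℍ, deriv (etaQuotient 20 (expFn [(2, -1), (4, 1), (10, 5), (20, -5)]) ∘ ofComplex) τ
      = -(2 * π * I * φ τ) * (2 * etaQuotient 40 (expFn [(4, 2), (10, 4), (20, -6)]) τ)) :
    ∃ L₁ : PeriodPair, L₁.g₂ = 28 ∧ L₁.g₃ = 24 ∧ ∀ z ∈ periodLattice φ, z ∈ L₁.lattice := by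
  obtain ⟨L₁, hg2, hg3⟩ := PeriodPair.uniformization_holds 28 24 (by norm_num)
  have hmd : MDifferentiable 𝓘(ℂ) 𝓘(ℂ) (fun τ : ℍ ↦ etaQuotient 20 (expFn [(2, -1), (4, 1), (10, 5), (20, -5)]) τ - 1) :=
    (mdifferentiable_etaQuotient 20 _).sub mdifferentiable_const
  have hc1 := (cuspCoeff_phi40 φ hφ).1
  have hne : φ ≠ 0 := by rintro rfl; rw [cuspCoeff, CuspForm.coe_zero, UpperHalfPlane.qExpansion_zero, map_zero] at hc1; exact zero_ne_one hc1
  refine ⟨L₁, hg2, hg3, periodLattice_le_of_deriv_sq φ hne L₁ _ hmd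
    (fun γ τ ↦ by simp only [x40_smul γ γ.2 τ]) ?_ (by rw [hg2, hg3]; exact exists_x40_nondegenerate)⟩
  intro τ
  have hderiv : deriv ((fun σ : ℍ ↦ etaQuotient 20 (expFn [(2, -1), (4, 1), (10, 5), (20, -5)]) σ - 1) ∘ ofComplex) τ
      = deriv (etaQuotient 20 (expFn [(2, -1), (4, 1), (10, 5), (20, -5)]) ∘ ofComplex) τ := by
    rw [show ((fun σ : ℍ ↦ etaQuotient 20 (expFn [(2, -1), (4, 1), (10, 5), (20, -5)]) σ - 1) ∘ ofComplex)
      = fun z ↦ (etaQuotient 20 (expFn [(2, -1), (4, 1), (10, 5), (20, -5)]) ∘ ofComplex) z - 1 from rfl, deriv_sub_const]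
  rw [hderiv, h2 τ, hg2, hg3]
  linear_combination 4 * (2 * π * I * φ τ) ^ 2 * (h1 τ).symm

end Phi

end Summit.BirchSwinnertonDyer.BirchSwinnertonDyer.Theorems.ManinLocalTwoThree.EtaIdentityReductionForty

end
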